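import Mathlib
import HarnessLib
import Summits.NavierStokesRegularity.NavierStokesRegularity.Theorems.TypeIQuarterGateScarEnvelopeTypeIForcedTsaiAlgSoundG
import Summits.NavierStokesRegularity.NavierStokesRegularity.Theorems.TypeIQuarterGateScarEnvelopeTypeIForcedTsaiAlgWitnessMG4
import Summits.NavierStokesRegularity.NavierStokesRegularity.Theorems.TypeIQuarterGateScarEnvelopeTypeIForcedTsaiAlgWitnessMG8
import Summits.NavierStokesRegularity.NavierStokesRegularity.Theorems.TypeIQuarterGateScarEnvelopeTypeIForcedTsaiAlgWitnessMG16

/-!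
# ARM B lane E-exact — multi-ℓ + swirl Type-I rows, EXACT WEIGHT, AS TREE THEOREMS: δ/M = 15.85 @4 · 16.99 @8 · 18.61 @16

Closers of kernel-checked LANEX-ALG v3 rows (Type-I-tail witnesses with exact far-field closure, the CERTIFIED
POLYNOMIAL LEVEL FLOOR `floorCertT3K30`, and the EXACT residual weight `(1+ρ)⁵` — no AM-GM majorant) through
`AlgRowG.sound` (`…ForcedTsaiAlgSoundG`): certified UPPER bounds on the forced-Tsai modulus in the tree currency
(`ℝ³`, weight `(1+ρ)⁵`, level on `B₁₀`):
`δ*(4) ≤ 63.39` (δ/M = 15.85; v2 row (AM-GM radii) 16.24); `δ*(8) ≤ 135.9` (δ/M = 16.99; v2 row (AM-GM radii) 17.47); `δ*(16) ≤ 297.7` (δ/M = 18.61; v2 row (AM-GM radii) 19.30).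
«Near-profiles this good EXIST»; UPPER bounds only; excludes nothing; nothing about NS regularity; 23843 / H3 OPEN.
-/

set_option linter.dupNamespace false

namespace Summit.NavierStokesRegularity.NavierStokesRegularity.Cruxes.ScarEnvelopeTypeI.ForcedTsai

/-- `δ*(4) ≤ 31697/500` ≈ 63.3940 (Type-I-tail class, exact closure, certified polynomial floor, EXACT weight; δ/M = 15.85; v2 row (AM-GM radii) 16.24). -/
theorem forcedTsaiModulusLE_algG_MG_4 : ForcedTsaiModulusLE (4 : ℝ) (31697 / 500 : ℝ) := by
  have h := algRowGMG4r0.sound algRowGMG4r0_checkG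
  norm_num [algRowGMG4r0] at h
  exact h

/-- `δ*(8) ≤ 16986/125` ≈ 135.8880 (Type-I-tail class, exact closure, certified polynomial floor, EXACT weight; δ/M = 16.99; v2 row (AM-GM radii) 17.47). -/
theorem forcedTsaiModulusLE_algG_MG_8 : ForcedTsaiModulusLE (8 : ℝ) (16986 / 125 : ℝ) := by
  have h := algRowGMG8r0.sound algRowGMG8r0_checkG
  norm_num [algRowGMG8r0] at h
  exact h

/-- `δ*(16) ≤ 297687/1000` ≈ 297.6870 (Type-I-tail class, exact closure, certified polynomial floor, EXACT weight; δ/M = 18.61; v2 row (AM-GM radii) 19.30). -/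
theorem forcedTsaiModulusLE_algG_MG_16 : ForcedTsaiModulusLE (16 : ℝ) (297687 / 1000 : ℝ) := by
  have h := algRowGMG16r0.sound algRowGMG16r0_checkG
  norm_num [algRowGMG16r0] at h
  exact h

/-- Rounded: `ForcedTsaiModulusLE 16 298` (`δ/M ≤ 18.63` at level 16, multi-ℓ Type-I-tail class with swirl, exact weight; v2 was `16 309`). -/
theorem forcedTsaiModulusLE_16_298 : ForcedTsaiModulusLE (16 : ℝ) (298 : ℝ) :=
  forcedTsaiModulusLE_algG_MG_16.mono le_rfl (by norm_num)

end Summit.NavierStokesRegularity.NavierStokesRegularity.Cruxes.ScarEnvelopeTypeI.ForcedTsai
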